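import Summits.CriticalPhenomena.SAWScalingLimit.Theorems.SAWDevelopingMapHexConjectureMarginalWedgeDefs
import Summits.CriticalPhenomena.SAWScalingLimit.Theorems.SAWDevelopingMapObservableToSLEShortChordLocalityHelpers
import Summits.CriticalPhenomena.SAWScalingLimit.Theorems.SAWDefectDecoherenceDefectDecoherenceTmStarSums

/-!
# The cone-exterior escape floor (stub `stub_coneExteriorEscape` of the line
`marginal-reflex-wedge-cauchy-kernel`, crux `HexConjecture`, stmt-CriticalPhenomena-0808)

Crux `Summit.CriticalPhenomena.SAWScalingLimit.Theses.SAWDevelopingMap.HexConjecture`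
(Duminil-Copin–Smirnov 2012, Conjecture 1), line `marginal-reflex-wedge-cauchy-kernel`,
registered stub `stub_coneExteriorEscape` (`= ReflexFluxLine → ConeExteriorEscape` of the lead's
skeleton), over the objects of `…Theorems.SAWDevelopingMapHexConjectureMarginalWedgeDefs`
(`cornerEdge`, `IsReflexWedgeTruncation`, `dartSum`, `IsArcDart`, `Fc`, `Zm`, `farFlux`,
`rayZeroMass`, `raySixtyMass`).

**Statement.** If for every truncated reflex wedge `Λ = W_N`, `N ≥ 1`, the far flux of the
corner-rooted critical observable lies on the FLUX LINE
`Φ_N = (1/(2√3)) · (-i - e^{-iπ/8} (Z₀ - Z₆₀))`, then for every finite `Λ' ⊇ W_N` the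
`x_c`-masses `Z_{Λ'}(a → z)` summed over the arc darts `z` of `W_N` are at least `cos(π/8)`.

**Proof (elementary).** (1) For real `D`, `‖-i - e^{-iπ/8} D‖² = (D - sin(π/8))² + cos²(π/8)`,
so `‖Φ_N‖ ≥ cos(π/8) / (2√3)` (`Escape.cos_le_norm_fluxLine`). (2) By the triangle inequality
`‖Φ_N‖ ≤ Σ_arc ‖mid(z) - c_v‖ ‖F(z)‖ = (1/(2√3)) Σ_arc ‖F(z)‖`, adjacent honeycomb centres being
at distance `1/√3` (`Escape.norm_hexMidpoint_sub_hexCenter`, from the tree's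
`TipMartingale.dist_hexCenter_of_adj`). (3) `‖F(z)‖ ≤ Z_{W_N}(a → z)` termwise
(`norm_hexParafermionicObservable_le`), and (4) `Z_{W_N} ≤ Z_{Λ'}` for `W_N ⊆ Λ'`, a walk of the
smaller domain being a walk of the larger one with the same length (the tree's restriction
monotonicity `FloorRatio.archMass_mono`, here `Escape.Zm_mono`). (5) Chain and cancel the factor
`1/(2√3)`.

Sources: H. Duminil-Copin, S. Smirnov, Ann. of Math. 175 (2012) (arXiv:1007.0575), §3 (the
boundary evaluation in the proof of Lemma 2). Dependencies (in-tree, imported, not restated):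
`…Theorems.SAWDevelopingMapObservableToSLEShortChordLocalityHelpers` (`archMass_mono`),
`…Theorems.SAWDefectDecoherenceDefectDecoherenceTmStarSums` (`dist_hexCenter_of_adj`). This file:
helper lemmas in the sub-namespace `…MarginalWedge.Escape` and the registered stub, sorry-free.
-/

noncomputable section

open scoped BigOperators Classical
open Literature.Probability.LatticeModels Literature.Probability.RandomPlanarGeometry
  Literature.Probability.RandomPlanarGeometry.SAW
open Literature.Barriers.CriticalPhenomena.HexGreen (nbrs mem_nbrs_iff)
open Summit.CriticalPhenomena.SAWScalingLimit.Theorems.ObservableToSLE.FloorRatio (archMass_mono)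
open Summit.CriticalPhenomena.SAWScalingLimit.Theorems.DefectDecoherence.TipMartingale
  (dist_hexCenter_of_adj)

namespace Summit.CriticalPhenomena.SAWScalingLimit.Theorems.HexConjecture.MarginalWedge

namespace Escape

/-! ### Lattice distances -/

/-- For a neighbour `w` of `v` in `ℍ`, the half-edge from `c_v` to the mid-edge `mid{v, w}` has
length `1/(2√3)` (half the honeycomb edge length `1/√3`, `dist_hexCenter_of_adj`). [folklore] -/
theorem norm_hexMidpoint_sub_hexCenter {v w : HexVertex} (h : w ∈ nbrs v) :
    ‖hexMidpoint s(v, w) - hexCenter v‖ = 1 / (2 * Real.sqrt 3) := by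
  have hadj : hexGraph.Adj w v := ((mem_nbrs_iff v w).1 h).symm
  have hmid : hexMidpoint s(v, w) - hexCenter v = (hexCenter w - hexCenter v) / 2 := by
    rw [hexMidpoint_mk]; ring
  rw [hmid, norm_div, ← Complex.dist_eq, dist_hexCenter_of_adj hadj]
  simp only [Complex.norm_ofNat]
  ring

/-! ### Sums over boundary darts -/

/-- Triangle inequality for a dart sum. [folklore] -/
theorem norm_dartSum_le (Λ : Finset HexVertex) (P : HexVertex → HexVertex → Prop)
    (f : HexVertex → HexVertex → ℂ) : ‖dartSum Λ P f‖ ≤ dartSum Λ P fun v w => ‖f v w‖ := by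
  unfold dartSum
  exact (norm_sum_le _ _).trans (Finset.sum_le_sum fun v _ => norm_sum_le _ _)

/-- A dart sum is monotone in the summand, compared on the selected darts only. [folklore] -/
theorem dartSum_le_dartSum {Λ : Finset HexVertex} {P : HexVertex → HexVertex → Prop}
    {f g : HexVertex → HexVertex → ℝ}
    (h : ∀ v ∈ Λ, ∀ w ∈ nbrs v, w ∉ Λ → P v w → f v w ≤ g v w) :
    dartSum Λ P f ≤ dartSum Λ P g := by
  unfold dartSum
  refine Finset.sum_le_sum fun v hv => Finset.sum_le_sum fun w hw => ?_
  rw [Finset.mem_filter] at hw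
  exact h v hv w hw.1 hw.2.1 hw.2.2

/-- A constant factor comes out of a dart sum. [folklore] -/
theorem dartSum_const_mul (Λ : Finset HexVertex) (P : HexVertex → HexVertex → Prop) (c : ℝ)
    (f : HexVertex → HexVertex → ℝ) :
    (dartSum Λ P fun v w => c * f v w) = c * dartSum Λ P f := by
  unfold dartSum
  rw [Finset.mul_sum]
  exact Finset.sum_congr rfl fun v _ => (Finset.mul_sum _ _ _).symm

/-! ### The observable is dominated by the mass, and the mass is monotone in the domain -/

/-- `‖F(z)‖ ≤ Z_Λ(a → z)` for the corner-rooted critical observable (the winding factors are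
unimodular, `0 ≤ x_c`). [cite: DuminilCopinSmirnov2012, §3 proof of Lemma 2] -/
theorem norm_Fc_le (Λ : Finset HexVertex) (σ : ℝ) (z : Sym2 HexVertex) :
    ‖Fc Λ σ z‖ ≤ Zm Λ cornerEdge z :=
  norm_hexParafermionicObservable_le Λ cornerEdge hexCriticalFugacity_pos_lt_one.1.le σ z

/-- **Restriction monotonicity of the mass**: `Z_Λ(a → z) ≤ Z_{Λ'}(a → z)` for `Λ ⊆ Λ'` (every
walk of `Λ` is a walk of `Λ'` with the same visited vertices, and the weights `x_c^ℓ` are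
non-negative); this is the tree's `FloorRatio.archMass_mono`, read through `Zm`. [folklore] -/
theorem Zm_mono {Λ Λ' : Finset HexVertex} (h : Λ ⊆ Λ') (a z : Sym2 HexVertex) :
    Zm Λ a z ≤ Zm Λ' a z :=
  archMass_mono h a z

/-! ### The flux line misses the origin by `cos(π/8)` -/

/-- For real `D`, `‖-i - e^{-iπ/8} D‖² = cos²(π/8) + (D - sin(π/8))²`. [folklore] -/
theorem norm_sq_fluxLine (D : ℝ) :
    ‖-Complex.I - Complex.exp (-Complex.I * (Real.pi / 8)) * (D : ℂ)‖ ^ 2 =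
      Real.cos (Real.pi / 8) ^ 2 + (D - Real.sin (Real.pi / 8)) ^ 2 := by
  have hexp : Complex.exp (-Complex.I * (Real.pi / 8)) =
      Complex.exp ((-(Real.pi / 8) : ℝ) * Complex.I) := by
    congr 1; push_cast; ring
  rw [Complex.sq_norm, Complex.normSq_apply, hexp]
  simp only [Complex.sub_re, Complex.sub_im, Complex.neg_re, Complex.neg_im, Complex.I_re,
    Complex.I_im, Complex.mul_re, Complex.mul_im, Complex.exp_ofReal_mul_I_re,
    Complex.exp_ofReal_mul_I_im, Complex.ofReal_re, Complex.ofReal_im, Real.cos_neg, Real.sin_neg]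
  linear_combination (D ^ 2 - 1) * Real.cos_sq_add_sin_sq (Real.pi / 8)

/-- The flux line `-i - e^{-iπ/8} ℝ` stays at distance `≥ cos(π/8)` from the origin. [folklore] -/
theorem cos_le_norm_fluxLine (D : ℝ) :
    Real.cos (Real.pi / 8) ≤ ‖-Complex.I - Complex.exp (-Complex.I * (Real.pi / 8)) * (D : ℂ)‖ := by
  have hcos : 0 ≤ Real.cos (Real.pi / 8) := by
    apply Real.cos_nonneg_of_mem_Icc
    constructor <;> linarith [Real.pi_pos]
  refine (sq_le_sq₀ hcos (norm_nonneg _)).1 ?_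
  rw [norm_sq_fluxLine]
  nlinarith [sq_nonneg (D - Real.sin (Real.pi / 8))]

end Escape

/-- **The cone-exterior escape floor** (registered stub `stub_coneExteriorEscape` of the line
`marginal-reflex-wedge-cauchy-kernel`: `ReflexFluxLine → ConeExteriorEscape`). Given the flux line
`Φ_N = (1/(2√3)) (-i - e^{-iπ/8}(Z₀ - Z₆₀))` of every truncated reflex wedge `W_N`, `N ≥ 1`, the
`x_c`-masses from the corner root to the arc darts of `W_N`, computed in ANY finite domain
`Λ' ⊇ W_N`, sum to at least `cos(π/8)`: `cos(π/8)/(2√3) ≤ ‖Φ_N‖ ≤ (1/(2√3)) Σ_arc ‖F‖ ≤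
(1/(2√3)) Σ_arc Z_{W_N} ≤ (1/(2√3)) Σ_arc Z_{Λ'}`.
[cite: DuminilCopinSmirnov2012, §3 proof of Lemma 2] -/
theorem stub_coneExteriorEscape : (∀ (Λ : Finset HexVertex) (N : ℝ), 1 ≤ N → IsReflexWedgeTruncation Λ N → farFlux Λ N = (1 / (2 * Real.sqrt 3) : ℂ) * (-Complex.I - Complex.exp (-Complex.I * (Real.pi / 8)) * ((rayZeroMass Λ N - raySixtyMass Λ N : ℝ) : ℂ))) → ∀ (Λ Λ' : Finset HexVertex) (N : ℝ), 1 ≤ N → IsReflexWedgeTruncation Λ N → Λ ⊆ Λ' → Real.cos (Real.pi / 8) ≤ dartSum Λ (IsArcDart N) fun v w => Zm Λ' cornerEdge s(v, w) := by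
  intro hF Λ Λ' N hN hΛ hΛΛ'
  have hc : (0 : ℝ) < 1 / (2 * Real.sqrt 3) := by positivity
  -- upper bound: triangle inequality, half-edge length, `‖F‖ ≤ Z_Λ ≤ Z_{Λ'}`
  have hup : ‖farFlux Λ N‖ ≤
      1 / (2 * Real.sqrt 3) * dartSum Λ (IsArcDart N) fun v w => Zm Λ' cornerEdge s(v, w) := by
    unfold farFlux
    calc ‖dartSum Λ (IsArcDart N) fun v w =>
            (hexMidpoint s(v, w) - hexCenter v) * Fc Λ (5 / 8) s(v, w)‖
        ≤ dartSum Λ (IsArcDart N) fun v w =>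
            ‖(hexMidpoint s(v, w) - hexCenter v) * Fc Λ (5 / 8) s(v, w)‖ :=
          Escape.norm_dartSum_le _ _ _
      _ ≤ dartSum Λ (IsArcDart N) fun v w =>
            1 / (2 * Real.sqrt 3) * Zm Λ' cornerEdge s(v, w) := by
          refine Escape.dartSum_le_dartSum fun v _ w hw _ _ => ?_
          rw [norm_mul, Escape.norm_hexMidpoint_sub_hexCenter hw]
          exact mul_le_mul_of_nonneg_left
            ((Escape.norm_Fc_le _ _ _).trans (Escape.Zm_mono hΛΛ' _ _)) hc.le
      _ = 1 / (2 * Real.sqrt 3) * dartSum Λ (IsArcDart N) fun v w => Zm Λ' cornerEdge s(v, w) :=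
          Escape.dartSum_const_mul _ _ _ _
  -- lower bound: the flux line misses the origin by `cos(π/8)`
  have hlow : 1 / (2 * Real.sqrt 3) * Real.cos (Real.pi / 8) ≤ ‖farFlux Λ N‖ := by
    rw [hF Λ N hN hΛ, norm_mul]
    have hnorm : ‖(1 / (2 * Real.sqrt 3) : ℂ)‖ = 1 / (2 * Real.sqrt 3) := by
      rw [show (1 / (2 * Real.sqrt 3) : ℂ) = ((1 / (2 * Real.sqrt 3) : ℝ) : ℂ) by push_cast; rfl,
        Complex.norm_real, Real.norm_of_nonneg hc.le]
    rw [hnorm]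
    exact mul_le_mul_of_nonneg_left (Escape.cos_le_norm_fluxLine _) hc.le
  exact le_of_mul_le_mul_left (hlow.trans hup) hc

end Summit.CriticalPhenomena.SAWScalingLimit.Theorems.HexConjecture.MarginalWedge

end
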